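import Summits.Ventures.Crystal3D.Theorems.StickyWulffConstantCoaxialWallLawSeamSatCensusTwelve
import Summits.Ventures.Crystal3D.Kissing125.Geometry1
import HarnessLib

/-!
# One-free-pair kissing configurations: every node has at most FIVE contacts, and five only at common neighbours of the free pair
# (crux `CoaxialWallLaw`, stmt-Ventures-19481; lane F 'Certificates' v8.4, registered stubs `stub_satCensus12Narrow` / `stub_satCensus12Glide`;
#  certificate of record behind them: `KissingClassificationOneFree (5/2)` of '…SeamSatCensusTwelve')

HONEST FRAMING. Venture `Summits/Ventures/Crystal3D` (cell `crystal3d-full`); helper `--supports` stmt-Ventures-19481, no stub is closed.  The six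
kind-restricted census pieces of lane F v8.4 contain `SatCensus12Narrow/Glide`, which the tree derives from `KissingGap (5/2)` (PROVED, computational
grade) and the ONE-FREE-PAIR CLASSIFICATION `KissingClassificationOneFree (5/2)` (named, NOT proved; `satCensus12_of_oneFree`, p741052).  A certificate
for that classification is a re-run of Hales's method (the tree's K25 growth search `Kissing125`, structure `KConf`) with ONE pair exempt from the
dichotomy `dist = 2 ∨ dist ≥ 5/2`.  Among the `KConf` axioms the node bound `cdeg_le` («at most four contacts at a label», Hales 2012 Lemma 7,
`Kissing125.card_le_four_of_neighbours25`) is the one that FAILS under the exemption; this file proves its exact replacement: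

* `card_contacts_le_four_of_oneFree_of_not_mem` — in a one-free-pair `5/2`-configuration with exempt pair `(a, b)`, a node `v` all of whose listed
  contacts avoid `a` (or avoid `b`) has at most FOUR of them (Lemma 7 verbatim: the exemption is invisible);
* `card_contacts_le_five_of_oneFree` — every node has at most FIVE contacts;
* `card_contacts_le_four_of_oneFree` — at most FOUR unless BOTH `a` and `b` are among them.
So in the one-free-pair search the label degree is `≤ 4` except at the common contact-neighbours of the two exempt labels, where it is `≤ 5`
(and `= 5` forces the five tangent directions to have four consecutive tetrahedral gaps `arccos (1/3)` and one gap of `2π − 4 arccos (1/3) ≈ 77.9°`,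
whose chord `≈ 2.18 ∈ (2, 5/2)` IS the exempt pair — the D₅ₕ «two-ring» twelve-ball configuration realises this at both poles with TWO exempt pairs,
so the one-pair hypothesis is used exactly here).
NUMERICAL CONTEXT (this seat, evidence on 19481, memo ADVZ-C1-g21): the cuboctahedral and anticuboctahedral contact frameworks on `S²(2)` are
infinitesimally flexible (one flex) but every 23-bar sub-framework is still first-order obstructed against opening the released bar (residual `∝ t`), i.e.
no one-free-pair configuration bifurcates from FCC/HCP; a 120 000-start global search found none either (kit, cited in the memo).
WHAT THIS IS NOT: `KissingClassificationOneFree (5/2)` is NOT proved; no `SatCensus` piece is closed; F-C1 not moved.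
-/

noncomputable section

namespace Summit.Ventures.Crystal3D.Theorems

namespace TailResidue

open Summit.Ventures.Crystal3D Finset

/-- A one-free-pair gap configuration is a finite set (it has `ncard = 12`). -/
theorem IsGapKissingConfigOneFree.finite {δ : ℝ} {S : Set (EuclideanSpace ℝ (Fin 3))} (hS : IsGapKissingConfigOneFree δ S) : S.Finite :=
  Set.finite_of_ncard_ne_zero (by rw [hS.1]; norm_num)

/-- **Lemma 7 survives away from the exempt pair.**  In a one-free-pair `5/2`-configuration with exempt pair `(a, b)`, a finite set `F ⊆ S` of points at
distance `2` from `v` (contacts of the node `v`) that does not contain `a` has at most four elements: all pairs inside `F` obey the dichotomy, so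
`Kissing125.card_le_four_of_neighbours25` applies verbatim. [cite: Hales2012, Lemma 7] -/
theorem card_contacts_le_four_of_oneFree_of_not_mem {S : Set (EuclideanSpace ℝ (Fin 3))} (h12 : ∀ x ∈ S, ‖x‖ = 2) {a b : EuclideanSpace ℝ (Fin 3)}
    (hdich : ∀ x ∈ S, ∀ y ∈ S, x = y ∨ dist x y = 2 ∨ (5 / 2 : ℝ) ≤ dist x y ∨ (x = a ∧ y = b) ∨ (x = b ∧ y = a))
    {v : EuclideanSpace ℝ (Fin 3)} (hv : v ∈ S) {F : Finset (EuclideanSpace ℝ (Fin 3))} (hFS : ∀ u ∈ F, u ∈ S) (hd : ∀ u ∈ F, dist u v = 2)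
    (ha : a ∉ F ∨ b ∉ F) : F.card ≤ 4 := by
  refine Kissing125.card_le_four_of_neighbours25 (h12 v hv) (fun u hu => h12 u (hFS u hu)) hd fun u hu w hw hne => ?_
  rcases hdich u (hFS u hu) w (hFS w hw) with e | e | e | ⟨rfl, rfl⟩ | ⟨rfl, rfl⟩
  · exact absurd e hne
  · exact Or.inl e
  · exact Or.inr e
  · rcases ha with h | h
    · exact absurd hu h
    · exact absurd hw h
  · rcases ha with h | h
    · exact absurd hw h
    · exact absurd hu h

/-- **At most FIVE contacts at every node of a one-free-pair `5/2`-configuration.**  Remove `a` from the contact set and apply the four-bound.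
[cite: Hales2012, Lemma 7 (method)] -/
theorem card_contacts_le_five_of_oneFree {S : Set (EuclideanSpace ℝ (Fin 3))} (h12 : ∀ x ∈ S, ‖x‖ = 2) {a b : EuclideanSpace ℝ (Fin 3)}
    (hdich : ∀ x ∈ S, ∀ y ∈ S, x = y ∨ dist x y = 2 ∨ (5 / 2 : ℝ) ≤ dist x y ∨ (x = a ∧ y = b) ∨ (x = b ∧ y = a))
    {v : EuclideanSpace ℝ (Fin 3)} (hv : v ∈ S) {F : Finset (EuclideanSpace ℝ (Fin 3))} (hFS : ∀ u ∈ F, u ∈ S) (hd : ∀ u ∈ F, dist u v = 2) :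
    F.card ≤ 5 := by
  classical
  have h4 : (F.erase a).card ≤ 4 :=
    card_contacts_le_four_of_oneFree_of_not_mem h12 hdich hv (fun u hu => hFS u (mem_of_mem_erase hu)) (fun u hu => hd u (mem_of_mem_erase hu))
      (Or.inl (notMem_erase a F))
  have := pred_card_le_card_erase (s := F) (a := a)
  omega

/-- **At most FOUR contacts unless both exempt points are contacts of the node.**  [cite: Hales2012, Lemma 7 (method)] -/
theorem card_contacts_le_four_of_oneFree {S : Set (EuclideanSpace ℝ (Fin 3))} (h12 : ∀ x ∈ S, ‖x‖ = 2) {a b : EuclideanSpace ℝ (Fin 3)}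
    (hdich : ∀ x ∈ S, ∀ y ∈ S, x = y ∨ dist x y = 2 ∨ (5 / 2 : ℝ) ≤ dist x y ∨ (x = a ∧ y = b) ∨ (x = b ∧ y = a))
    {v : EuclideanSpace ℝ (Fin 3)} (hv : v ∈ S) {F : Finset (EuclideanSpace ℝ (Fin 3))} (hFS : ∀ u ∈ F, u ∈ S) (hd : ∀ u ∈ F, dist u v = 2)
    (h5 : 5 ≤ F.card) : a ∈ F ∧ b ∈ F := by
  by_contra h
  have : a ∉ F ∨ b ∉ F := by tauto
  have := card_contacts_le_four_of_oneFree_of_not_mem h12 hdich hv hFS hd this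
  omega

/-- **The contact set of a node, set form.**  For `v ∈ S`, `IsGapKissingConfigOneFree (5/2) S`: the set of points of `S` at distance `2` from `v` has
at most five elements. [cite: Hales2012, Lemma 7 (method)] -/
theorem ncard_contacts_le_five_of_oneFree {S : Set (EuclideanSpace ℝ (Fin 3))} (hS : IsGapKissingConfigOneFree (5 / 2) S)
    {v : EuclideanSpace ℝ (Fin 3)} (hv : v ∈ S) : {u ∈ S | dist u v = 2}.ncard ≤ 5 := by
  classical
  have hfin : {u ∈ S | dist u v = 2}.Finite := hS.finite.subset (fun u hu => hu.1)
  obtain ⟨-, h12, -, a, b, hdich⟩ := hS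
  rw [Set.ncard_eq_toFinset_card _ hfin]
  exact card_contacts_le_five_of_oneFree h12 hdich hv (fun u hu => ((Set.Finite.mem_toFinset hfin).1 hu).1)
    (fun u hu => ((Set.Finite.mem_toFinset hfin).1 hu).2)

/-- **Five contacts only at common neighbours of the exempt pair, set form.**  If the node `v` has five (or more) contacts then some exempt pair
`(a, b)` of the configuration consists of two contacts of `v`. [cite: Hales2012, Lemma 7 (method)] -/
theorem exists_exempt_contacts_of_five_le_ncard {S : Set (EuclideanSpace ℝ (Fin 3))} (hS : IsGapKissingConfigOneFree (5 / 2) S)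
    {v : EuclideanSpace ℝ (Fin 3)} (hv : v ∈ S) (h5 : 5 ≤ {u ∈ S | dist u v = 2}.ncard) :
    ∃ a b : EuclideanSpace ℝ (Fin 3), (∀ x ∈ S, ∀ y ∈ S, x = y ∨ dist x y = 2 ∨ (5 / 2 : ℝ) ≤ dist x y ∨ (x = a ∧ y = b) ∨ (x = b ∧ y = a)) ∧
      a ∈ S ∧ b ∈ S ∧ dist a v = 2 ∧ dist b v = 2 := by
  classical
  have hfin : {u ∈ S | dist u v = 2}.Finite := hS.finite.subset (fun u hu => hu.1)
  obtain ⟨-, h12, -, a, b, hdich⟩ := hS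
  rw [Set.ncard_eq_toFinset_card _ hfin] at h5
  have hmem : ∀ u ∈ hfin.toFinset, u ∈ S ∧ dist u v = 2 := fun u hu => (Set.Finite.mem_toFinset hfin).1 hu
  obtain ⟨ha, hb⟩ := card_contacts_le_four_of_oneFree h12 hdich hv (fun u hu => (hmem u hu).1) (fun u hu => (hmem u hu).2) h5
  exact ⟨a, b, hdich, (hmem a ha).1, (hmem b hb).1, (hmem a ha).2, (hmem b hb).2⟩

end TailResidue

end Summit.Ventures.Crystal3D.Theorems

end
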